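import Literature.MathematicalPhysics.QuantumFieldTheory.Balaban1983to89.B9Thm311ProjectionR
import Literature.MathematicalPhysics.QuantumFieldTheory.Balaban1983to89.B9B8KnitLetterGpDecay
import Literature.MathematicalPhysics.QuantumFieldTheory.Balaban1983to89.Node00.OpsYSectDReal
import Literature.MathematicalPhysics.QuantumFieldTheory.Balaban1983to89.Node00.OpsYGpUnits

/-!
# `Balaban1983to89.B9B8KnitLetterProjectionC` — p. 395 AT THE KNIT LETTER `parKnitY`: *«the operator Δ′_a is positive. This implies positivity of the
# operators G′, Q′G′²Q′\*, hence the existence of the operator R»* — `(Q′G′²Q′*)(U)` and `C(U) = (Q′G′²Q′*)⁻¹(U)` positive definite and the projection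
# `R(U) = I − G′Q′*(Q′G′²Q′*)⁻¹Q′G′` of (3.25) a symmetric idempotent with `Q′G′R = 0`, at print's composite-contour transporters; the consumer's laws
# (E2) `cinv_range`, (U2) `cinv_range'`, (E16) `r_real`, and for [B8] (1.91)'s `H′ = G′²Q′*(Q′G′²Q′*)⁻¹` the laws (E11) `qp_hp`, (E10) `hp_real`,
# exactly (junction J-B file 13)

statement-level skeleton of published theorems with citation tags; proofs where landed; nothing here is a claim about the
Yang–Mills mass gap

T. Bałaban, *Propagators for lattice gauge theories in a background field*, Commun. Math. Phys. **99** (1985) 389–434 [`Balaban1985BackgroundPropagators`,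
"[B9]"]; T. Bałaban, *Spaces of regular gauge field configurations on a lattice and gauge fixing conditions*, Commun. Math. Phys. **99** (1985) 75–102
[`Balaban1985RegularSpaces`, "[B8]"]; T. Bałaban, *Propagators and renormalization transformations for lattice gauge theories. I*, Commun. Math. Phys.
**95** (1984) 17–40 [`Balaban1984PropagatorsI`, "[3]"].

THE PRINT.  [B9] (3.20)–(3.21) p. 394: `R = R(U)` *«is an orthogonal projection in the Hilbert space L²(Ω₀, 𝔤) onto the subspace … {λ : Q′λ = 0}»*;
(3.25) p. 394: `Rf = (I − G′Q′*(Q′G′²Q′*)⁻¹Q′G′)f`, `G′ = (Δ′_a)⁻¹`; p. 395: *«Assuming some regularity of the configuration U it can be easily shown that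
the operator Δ′_a is positive. This implies positivity of the operators G′, Q′G′²Q′\*, hence the existence of the operator R»*; Thm 3.2 p. 398 (the kernel
of `(Q′G′²Q′*)⁻¹`), Thm 3.11 p. 416.  [B8] p. 93: *«Q′G′R = Q′G′(I − G′Q′*(Q′G′²Q′*)⁻¹Q′G′) = 0»*; the consumer's `B8Thm2TorusLetters.LettersAt` records the
letter `C = (Q′G′²Q′ᵀ)⁻¹` with the laws (E2) `Q′G′G′Q′ᵀCQ′f = Q′f`, (U2) `Q′ᵀCQ′G′G′Q′ᵀφ = Q′ᵀφ`, `R = 1 − G′Q′ᵀCQ′G′` with (E16) (reality), and [B8] (1.91)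
p. 91 `H′ = G′²Q′*(Q′G′²Q′*)⁻¹` with (E11) `Q′H′ = 1`, (E10) (reality).

WHY THIS FILE ∕ THE ARGUMENT.  dag-n06-j proved all of this at def-Y's letter of record `parSymY` (`B9Thm311PosAtRecordV4` §6, `B9Thm311ProjectionR` §1)
from FOUR inputs: `Δ′_a(U) > 0`, `Δ′_a(U)` symmetric, `Q′*` the `W`-adjoint of `Q′`, `Q′*` injective — via [3] p. 25's argument `⟨φ, Q′G′²Q′*φ⟩ = ‖G′Q′*φ‖²
> 0` in the real reading coordinates (`posDef_qggqs`).  At the knit letter the four inputs are theorems of the junction: `deltaPrimeAY_parKnitY_posDefTr`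
(file 3), `symm0_parKnitY` (file 7), `isAdjTr_QpY_QpsY_of_mem` at `parS := parKnitY` (dag-n06-j, any `G`-valued transporters), `qpsY_injective` (any
transporters).  So the proofs are dag-n06-j's, verbatim, with `parSymY ↦ parKnitY` and the extra hypothesis «knit legs `G`-valued» (supplied on [B7]'s class
(52) by file 4b `parKnitY_mem_of_pdev`).  The consumer shapes (E2)∕(U2) are `XX⁻¹ = 1` ∕ `X⁻¹X = 1` composed with `Q′` ∕ `Q′*`; (E16) is def-Y's reality
calculus (`RY_isRealOpY`); the `η²`-scaling of the consumer's `G′` is absorbed by `Node00.OpsYGpUnits` (`isUnit_XY_smul_Gp_iff`, `RY_smul_Gp`).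

CITATION HEADER (lean-in-tree rule).  Cell `lit-balaban`, sub-row G-B9-LETTERS, junction J-B file 13 → seat `lit-balaban-p33` gen 94.  REUSED BY NAME:
`Node00.{XY, XinvY, RY, QpY, QpsY, GpY, deltaPrimeAY, IsRealOpY, RY_isRealOpY, XinvY_isRealOpY, QpsY_isRealOpY, GpY_isRealOpY, isUnit_XY_smul_Gp_iff,
RY_smul_Gp}` (def-Y), `B9Thm311ReadingCoords.{conj311, …_conj311_realify311_iff, isUnit_of_posDefTr, conj311_apply_conj311_inverse}`,
`B9Thm311ReadingAtLetters.{wB, eS311, eB311}`, `B9Thm311Whole.posDef_qggqs`, `B9Thm311AdjointAtLetters.{qpsY_injective, isAdjTr_QpY_QpsY_of_mem}`,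
`B9Thm311AdjointPairs.{GpY_isSymmTr, RY_isSymmTr}`, `B9Thm311DeltaPrimePos.{posDefTr_ringInverse, trIP_self_nonneg}` (dag-n06-j); `B9Thm311PositivityKnitLetter.{deltaPrimeAY_parKnitY_posDefTr, GpY_parKnitY_posDefTr, isUnit_deltaPrimeAY_parKnitY}` (file 3),
`B9B8KnitLetterGpDecay.symm0_parKnitY` (file 7).

WHAT THIS FILE PROVES (sorry-free; no definitions; nothing of [B9]'s analysis asserted).
* §1 `adj_parKnitY` (`Q′*` is the `W`-adjoint of `Q′` at `G`-valued knit legs), ★★ `XY_parKnitY_posDefTr` (`(Q′G′²Q′*)(U; parKnitY) > 0` for the block-volume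
  product), `isUnit_XY_parKnitY`, ★★ `XinvY_parKnitY_posDefTr` (`C > 0`), ★★★ `thm311_firstThree_parKnitY` (p. 395's three positivities as ONE theorem),
  `isUnit_XY_smul_GpY_parKnitY` (the `η²`-scaled letter).
* §2 `XinvY_comp_XY_parKnitY`, `XY_comp_XinvY_parKnitY`, ★ `RY_parKnitY_idempotent`, ★ `QpY_GpY_RY_parKnitY` ([B8] p. 93 «Q′G′R = 0»), `RY_parKnitY_isSymmTr`,
  `trIP_RY_parKnitY_self`, `trIP_RY_parKnitY_self_nonneg`, ★ `trIP_RY_parKnitY_self_le` (`R` is an `L²`-contraction, Pythagoras) — (3.20)–(3.21), (3.25)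
  at the knit letter.
* §3 the consumer's shapes: `E2_of_isUnit_XY` ∕ `U2_of_isUnit_XY` (any transporters, any letter `Gp` with `X` a unit), ★★ `knit_E2` ∕ `knit_U2` (at `G′(U; parKnitY)`),
  `knit_E2_smul` ∕ `knit_U2_smul` (at `c·G′`, `c ≠ 0` — the consumer's `η²G′`), `RY_parKnitY_smul` (`R` is blind to the units of `G′`).
* §4 (E16): `XinvY_parKnitY_isRealOpY`, ★ `RY_parKnitY_isRealOpY`, ★★ `isSelfAdjoint_RY_parKnitY_apply` (`f` hermitian-valued ⇒ `Rf` hermitian-valued; with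
  `RY_parKnitY_smul` the same at `c·G′`).
* §5 [B8] (1.91) `H′ = G′²Q′\*C` at the knit letter: `E11_of_isUnit_XY` (generic), ★★ `knit_E11` ∕ `knit_E11_smul` ((E11) `Q′(H′Y) = Y` exactly), ★ `knit_Hprime_star`
  (`H′(Y⋆) = (H′Y)⋆`), ★★ `knit_E10` ((E10) `Y = −X⋆ ⇒ H′Y = −(H′X)⋆`, the consumer's shape), `isSelfAdjoint_knit_Hprime_apply`.

HONEST SCOPE.  Finite-dimensional algebra at def-Y's carrier: positivity and invertibility of `Q′G′²Q′*` at EVERY `G`-valued background with `G`-valued knit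
legs (no smallness) — the EXISTENCE half of the letters `C`, `R`, `H′` (p. 395, (1.91)), NOT Theorem 3.2's bounds (3.48) on the kernel of `C` (sub-row
G-B9-LETTERS M5.6), hence neither (E15) nor (E6)–(E8).  Count-neutral; nothing continuum, nothing about OS axioms or the mass gap.  No `sorry`, no `axiom`, no `instance`, no `notation`.  NEW file; nothing
landed is modified.  Net new unproved facts: 0.  Seat `lit-balaban-p33` gen 94, 2026-08-28.
-/

noncomputable section

namespace Literature.MathematicalPhysics.QuantumFieldTheory.Balaban1983to89.B9B8KnitLetterProjectionC

open Node00 B6KLevelCensusIndexV1 B6GlobalChartV1 B9BackgroundsKLevelV1 B9Eq39Adjoint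
open B9Thm311Whole B9Thm311ReadingCoords B9Thm311ReadingAtLetters B9Thm311AdjointAtLetters B9Thm311AdjointPairs B9Thm311DeltaPrimePos
open B9B8AveragingJunction (parKnitY)
open B9Thm311PositivityKnitLetter (deltaPrimeAY_parKnitY_posDefTr GpY_parKnitY_posDefTr isUnit_deltaPrimeAY_parKnitY)
open B9B8KnitLetterGpDecay (symm0_parKnitY)
open scoped Matrix Matrix.Norms.L2Operator

variable {d ℓ : ℕ} {hd : 1 ≤ d + 1} {hL : Odd (ℓ + 1) ∧ 1 < ℓ + 1} {b₀ b₁ : ℝ} {N : ℕ}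
variable (i : KIdx d ℓ hd hL b₀ b₁) {G : Subgroup (Matrix (Fin N) (Fin N) ℂ)ˣ}

/-! ## §1 The third operator of Theorem 3.11 at the knit letter: `(Q′G′²Q′*)(U)` and its inverse `C(U)` are positive definite -/

section Third

/-- `adj` at the knit letter: `Q′*(U)` is the `W`-adjoint of `Q′(U)` for `G`-valued knit legs, `G ≤ U(N)` (dag-n06-j's `isAdjTr_QpY_QpsY_of_mem`).
[cite: Balaban1985BackgroundPropagators, (3.19) p.393; Balaban1984PropagatorsII, (2.69) p.235] -/
theorem adj_parKnitY (hG : G ≤ B7Prop2Explicit.unitaryUnits (Matrix (Fin N) (Fin N) ℂ)) (U : CfgY (Matrix (Fin N) (Fin N) ℂ) i)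
    (hpar : ∀ z w : SiteY i, parKnitY i U z w ∈ G) : IsAdjTr (fun _ => (1 : ℝ)) (wB i) (QpY i (parKnitY i) U) (QpsY i (parKnitY i) U) :=
  isAdjTr_QpY_QpsY_of_mem i hG (parKnitY i) U hpar

/-- ★★ **`(Q′G′²Q′\*)(U)` AT THE KNIT LETTER IS POSITIVE DEFINITE for the block-volume scalar product**, at every `G`-valued `U` with `G`-valued knit legs,
`G ≤ U(N)`: [3] p. 25's argument (`G′` symmetric positive, `Q′\*` injective) — dag-n06-j's `XY_parSymY_posDefTr` verbatim with `parSymY ↦ parKnitY`, its four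
inputs being `deltaPrimeAY_parKnitY_posDefTr`, `symm0_parKnitY`, `adj_parKnitY`, `qpsY_injective`.
[cite: Balaban1984PropagatorsI, p.25; Balaban1985BackgroundPropagators, p.395 («positivity of … Q′G′²Q′\*»), (3.25) p.394, Thm 3.11 p.416] -/
theorem XY_parKnitY_posDefTr (hG : G ≤ B7Prop2Explicit.unitaryUnits (Matrix (Fin N) (Fin N) ℂ)) {U : CfgY (Matrix (Fin N) (Fin N) ℂ) i}
    (hU : ∀ μ x, U μ x ∈ G) (hpar : ∀ z w : SiteY i, parKnitY i U z w ∈ G) : PosDefTr (wB i) (XY i (parKnitY i) (GpY i (parKnitY i)) U) := by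
  have hu0 : IsUnit (deltaPrimeAY i (parKnitY i) U) := isUnit_deltaPrimeAY_parKnitY i hG hU hpar
  have hright : ∀ v, conj311 (eS311 N i) (eS311 N i) (deltaPrimeAY i (parKnitY i) U)
      (conj311 (eS311 N i) (eS311 N i) (GpY i (parKnitY i) U) v) = v := fun v => conj311_apply_conj311_inverse _ hu0 v
  have hsymm0 := (symm_conj311_realify311_iff (w := fun _ : SiteY i => (1 : ℝ)) (hw := fun _ => one_pos)
    (deltaPrimeAY i (parKnitY i) U)).mpr (symm0_parKnitY i hG hU hpar)
  have hg : ∀ u v, inner ℝ (conj311 (eS311 N i) (eS311 N i) (GpY i (parKnitY i) U) u) v =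
      inner ℝ u (conj311 (eS311 N i) (eS311 N i) (GpY i (parKnitY i) U) v) := fun u v => by
    conv_lhs => rw [← hright v]
    conv_rhs => rw [← hright u]
    exact (hsymm0 _ _).symm
  have hginj : Function.Injective (conj311 (eS311 N i) (eS311 N i) (GpY i (parKnitY i) U)) := fun u v huv => by
    rw [← hright u, ← hright v, huv]
  have hadj := (adj_conj311_realify311_iff (w := fun _ : SiteY i => (1 : ℝ)) (hw := fun _ => one_pos)
    (w' := wB i) (hw' := wB_pos i) (QpY i (parKnitY i) U) (QpsY i (parKnitY i) U)).mpr (adj_parKnitY i hG U hpar)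
  have hqs := (injective_conj311_iff (eB311 N i) (eS311 N i) (QpsY i (parKnitY i) U)).mpr (qpsY_injective i (parKnitY i) U)
  have hpd := posDef_qggqs hadj hg hginj hqs
  have hconj : conj311 (eS311 N i) (eB311 N i) (QpY i (parKnitY i) U) ∘ₗ
      conj311 (eS311 N i) (eS311 N i) (GpY i (parKnitY i) U) ∘ₗ conj311 (eS311 N i) (eS311 N i) (GpY i (parKnitY i) U) ∘ₗ
        conj311 (eB311 N i) (eS311 N i) (QpsY i (parKnitY i) U) =
      conj311 (eB311 N i) (eB311 N i) (XY i (parKnitY i) (GpY i (parKnitY i)) U) := by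
    rw [XY, conj311_comp (eY := eS311 N i), conj311_comp (eY := eS311 N i), conj311_comp (eY := eS311 N i)]
  change B9Thm311Data.PosDef (conj311 (eS311 N i) (eB311 N i) (QpY i (parKnitY i) U) ∘ₗ
      conj311 (eS311 N i) (eS311 N i) (GpY i (parKnitY i) U) ∘ₗ conj311 (eS311 N i) (eS311 N i) (GpY i (parKnitY i) U) ∘ₗ
        conj311 (eB311 N i) (eS311 N i) (QpsY i (parKnitY i) U)) at hpd
  rw [hconj] at hpd
  exact (posDef_conj311_realify311_iff _).mp hpd

/-- hence `(Q′G′²Q′\*)(U)` at the knit letter is a UNIT: def-Y's `XinvY = Ring.inverse (Q′G′²Q′\*)(U)` IS the two-sided inverse `C(U)` there — p. 395's *«hence the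
existence of the operator R»* (no Theorem 3.2 needed for existence). [cite: Balaban1985BackgroundPropagators, p.395, (3.25) p.394, (3.48) p.398] -/
theorem isUnit_XY_parKnitY (hG : G ≤ B7Prop2Explicit.unitaryUnits (Matrix (Fin N) (Fin N) ℂ)) {U : CfgY (Matrix (Fin N) (Fin N) ℂ) i}
    (hU : ∀ μ x, U μ x ∈ G) (hpar : ∀ z w : SiteY i, parKnitY i U z w ∈ G) : IsUnit (XY i (parKnitY i) (GpY i (parKnitY i)) U) :=
  isUnit_of_posDefTr (XY_parKnitY_posDefTr i hG hU hpar)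

/-- ★★ **`C(U) = (Q′G′²Q′\*)⁻¹(U)` AT THE KNIT LETTER IS POSITIVE DEFINITE** (block-volume product). [cite: Balaban1985BackgroundPropagators, p.395, Thm 3.11 p.416] -/
theorem XinvY_parKnitY_posDefTr (hG : G ≤ B7Prop2Explicit.unitaryUnits (Matrix (Fin N) (Fin N) ℂ)) {U : CfgY (Matrix (Fin N) (Fin N) ℂ) i}
    (hU : ∀ μ x, U μ x ∈ G) (hpar : ∀ z w : SiteY i, parKnitY i U z w ∈ G) : PosDefTr (wB i) (XinvY i (parKnitY i) (GpY i (parKnitY i)) U) :=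
  posDefTr_ringInverse (XY_parKnitY_posDefTr i hG hU hpar)

/-- ★★★ **p. 395 AT THE KNIT LETTER, AS ONE THEOREM**: at every `G`-valued `U` with `G`-valued knit legs (`G ≤ U(N)`), `Δ′_a(U)`, `G′(U) = Δ′_a(U)⁻¹` and
`(Q′G′²Q′\*)⁻¹(U)` — all at print's transporters `parKnitY` — are positive definite. [cite: Balaban1985BackgroundPropagators, p.395, Thm 3.11 p.416, (3.24)–(3.25) p.394] -/
theorem thm311_firstThree_parKnitY (hG : G ≤ B7Prop2Explicit.unitaryUnits (Matrix (Fin N) (Fin N) ℂ)) {U : CfgY (Matrix (Fin N) (Fin N) ℂ) i}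
    (hU : ∀ μ x, U μ x ∈ G) (hpar : ∀ z w : SiteY i, parKnitY i U z w ∈ G) :
    PosDefTr (fun _ => (1 : ℝ)) (deltaPrimeAY i (parKnitY i) U) ∧ PosDefTr (fun _ => (1 : ℝ)) (GpY i (parKnitY i) U) ∧
      PosDefTr (wB i) (XinvY i (parKnitY i) (GpY i (parKnitY i)) U) :=
  ⟨deltaPrimeAY_parKnitY_posDefTr i hG hU hpar, GpY_parKnitY_posDefTr i hG hU hpar, XinvY_parKnitY_posDefTr i hG hU hpar⟩

/-- the `c`-scaled letter (`c ≠ 0`; the consumer's `η²G′`) gives a unit `Q′(cG′)²Q′\*` too. [cite: Balaban1985BackgroundPropagators, (3.25) p.394; Balaban1985RegularSpaces, (1.95) p.92, bookkeeping] -/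
theorem isUnit_XY_smul_GpY_parKnitY (hG : G ≤ B7Prop2Explicit.unitaryUnits (Matrix (Fin N) (Fin N) ℂ)) {U : CfgY (Matrix (Fin N) (Fin N) ℂ) i}
    (hU : ∀ μ x, U μ x ∈ G) (hpar : ∀ z w : SiteY i, parKnitY i U z w ∈ G) {c : ℂ} (hc : c ≠ 0) :
    IsUnit (XY i (parKnitY i) (c • GpY i (parKnitY i)) U) :=
  (isUnit_XY_smul_Gp_iff (parKnitY i) (GpY i (parKnitY i)) hc U).mpr (isUnit_XY_parKnitY i hG hU hpar)

end Third

/-! ## §2 The projection `R(U)` of (3.25) at the knit letter: idempotent, `Q′G′R = 0`, symmetric, nonnegative -/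

section Projection

/-- `C(U) ∘ (Q′G′²Q′\*)(U) = 1` at the knit letter. [cite: Balaban1985BackgroundPropagators, (3.25) p.394, p.395] -/
theorem XinvY_comp_XY_parKnitY (hG : G ≤ B7Prop2Explicit.unitaryUnits (Matrix (Fin N) (Fin N) ℂ)) {U : CfgY (Matrix (Fin N) (Fin N) ℂ) i}
    (hU : ∀ μ x, U μ x ∈ G) (hpar : ∀ z w : SiteY i, parKnitY i U z w ∈ G) :
    XinvY i (parKnitY i) (GpY i (parKnitY i)) U ∘ₗ XY i (parKnitY i) (GpY i (parKnitY i)) U = LinearMap.id :=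
  Ring.inverse_mul_cancel _ (isUnit_XY_parKnitY i hG hU hpar)

/-- `(Q′G′²Q′\*)(U) ∘ C(U) = 1` at the knit letter. [cite: Balaban1985BackgroundPropagators, (3.25) p.394, p.395] -/
theorem XY_comp_XinvY_parKnitY (hG : G ≤ B7Prop2Explicit.unitaryUnits (Matrix (Fin N) (Fin N) ℂ)) {U : CfgY (Matrix (Fin N) (Fin N) ℂ) i}
    (hU : ∀ μ x, U μ x ∈ G) (hpar : ∀ z w : SiteY i, parKnitY i U z w ∈ G) :
    XY i (parKnitY i) (GpY i (parKnitY i)) U ∘ₗ XinvY i (parKnitY i) (GpY i (parKnitY i)) U = LinearMap.id :=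
  Ring.mul_inverse_cancel _ (isUnit_XY_parKnitY i hG hU hpar)

/-- ★ **`R(U) = I − G′Q′\*(Q′G′²Q′\*)⁻¹Q′G′` AT THE KNIT LETTER IS AN IDEMPOTENT** (dag-n06-j's `RY_parSymY_idempotent`, `parSymY ↦ parKnitY`).
[cite: Balaban1985BackgroundPropagators, (3.20) p.394 («orthogonal projection»), (3.25) p.394] -/
theorem RY_parKnitY_idempotent (hG : G ≤ B7Prop2Explicit.unitaryUnits (Matrix (Fin N) (Fin N) ℂ)) {U : CfgY (Matrix (Fin N) (Fin N) ℂ) i}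
    (hU : ∀ μ x, U μ x ∈ G) (hpar : ∀ z w : SiteY i, parKnitY i U z w ∈ G) :
    RY i (parKnitY i) (GpY i (parKnitY i)) U ∘ₗ RY i (parKnitY i) (GpY i (parKnitY i)) U = RY i (parKnitY i) (GpY i (parKnitY i)) U := by
  set Gp := GpY i (parKnitY i) U
  set Qp := QpY i (parKnitY i) U
  set Qps := QpsY i (parKnitY i) U
  set Xi := XinvY i (parKnitY i) (GpY i (parKnitY i)) U
  have hkey : Xi ∘ₗ (Qp ∘ₗ (Gp ∘ₗ (Gp ∘ₗ (Qps ∘ₗ (Xi ∘ₗ (Qp ∘ₗ Gp)))))) = Xi ∘ₗ (Qp ∘ₗ Gp) := by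
    have h := congrArg (fun S => S ∘ₗ (Xi ∘ₗ (Qp ∘ₗ Gp))) (XinvY_comp_XY_parKnitY i hG hU hpar)
    simp only [XY, LinearMap.comp_assoc, LinearMap.id_comp] at h
    exact h
  have hP : (Gp ∘ₗ (Qps ∘ₗ (Xi ∘ₗ (Qp ∘ₗ Gp)))) ∘ₗ (Gp ∘ₗ (Qps ∘ₗ (Xi ∘ₗ (Qp ∘ₗ Gp)))) = Gp ∘ₗ (Qps ∘ₗ (Xi ∘ₗ (Qp ∘ₗ Gp))) := by
    simp only [LinearMap.comp_assoc]
    rw [hkey]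
  have hR : RY i (parKnitY i) (GpY i (parKnitY i)) U = LinearMap.id - Gp ∘ₗ (Qps ∘ₗ (Xi ∘ₗ (Qp ∘ₗ Gp))) := rfl
  rw [hR, LinearMap.sub_comp, LinearMap.id_comp, LinearMap.comp_sub, LinearMap.comp_id, hP, sub_self, sub_zero]

/-- ★ **`Q′(U)G′(U)R(U) = 0` AT THE KNIT LETTER** — [B8] p. 93 *«Q′G′R = Q′G′(I − G′Q′\*(Q′G′²Q′\*)⁻¹Q′G′) = 0»*, [B9] (3.20)–(3.21) (the range of `R` lies in
`{λ : Q′G′λ = 0}`). [cite: Balaban1985RegularSpaces, p.93; Balaban1985BackgroundPropagators, (3.20)–(3.21) p.394, (3.25) p.394] -/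
theorem QpY_GpY_RY_parKnitY (hG : G ≤ B7Prop2Explicit.unitaryUnits (Matrix (Fin N) (Fin N) ℂ)) {U : CfgY (Matrix (Fin N) (Fin N) ℂ) i}
    (hU : ∀ μ x, U μ x ∈ G) (hpar : ∀ z w : SiteY i, parKnitY i U z w ∈ G) :
    QpY i (parKnitY i) U ∘ₗ GpY i (parKnitY i) U ∘ₗ RY i (parKnitY i) (GpY i (parKnitY i)) U = 0 := by
  set Gp := GpY i (parKnitY i) U
  set Qp := QpY i (parKnitY i) U
  set Qps := QpsY i (parKnitY i) U
  set Xi := XinvY i (parKnitY i) (GpY i (parKnitY i)) U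
  have hkey : Qp ∘ₗ (Gp ∘ₗ (Gp ∘ₗ (Qps ∘ₗ (Xi ∘ₗ (Qp ∘ₗ Gp))))) = Qp ∘ₗ Gp := by
    have h := congrArg (fun S => S ∘ₗ (Qp ∘ₗ Gp)) (XY_comp_XinvY_parKnitY i hG hU hpar)
    simp only [XY, LinearMap.comp_assoc, LinearMap.id_comp] at h
    exact h
  have hR : RY i (parKnitY i) (GpY i (parKnitY i)) U = LinearMap.id - Gp ∘ₗ (Qps ∘ₗ (Xi ∘ₗ (Qp ∘ₗ Gp))) := rfl
  rw [hR, LinearMap.comp_sub, LinearMap.comp_sub, LinearMap.comp_id, hkey, sub_self]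

/-- pointwise: `Q′G′(Rf) = 0` for every `f`. [cite: Balaban1985RegularSpaces, p.93; Balaban1985BackgroundPropagators, (3.20)–(3.21) p.394] -/
theorem QpY_GpY_RY_parKnitY_apply (hG : G ≤ B7Prop2Explicit.unitaryUnits (Matrix (Fin N) (Fin N) ℂ)) {U : CfgY (Matrix (Fin N) (Fin N) ℂ) i}
    (hU : ∀ μ x, U μ x ∈ G) (hpar : ∀ z w : SiteY i, parKnitY i U z w ∈ G) (f : SiteY i → Matrix (Fin N) (Fin N) ℂ) :
    QpY i (parKnitY i) U (GpY i (parKnitY i) U (RY i (parKnitY i) (GpY i (parKnitY i)) U f)) = 0 := by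
  have h := LinearMap.congr_fun (QpY_GpY_RY_parKnitY i hG hU hpar) f
  rwa [LinearMap.comp_apply, LinearMap.comp_apply, LinearMap.zero_apply] at h

/-- `R(U)` at the knit letter is symmetric for the site trace pairing. [cite: Balaban1985BackgroundPropagators, (3.20) p.394, (3.25) p.394] -/
theorem RY_parKnitY_isSymmTr (hG : G ≤ B7Prop2Explicit.unitaryUnits (Matrix (Fin N) (Fin N) ℂ)) {U : CfgY (Matrix (Fin N) (Fin N) ℂ) i}
    (hU : ∀ μ x, U μ x ∈ G) (hpar : ∀ z w : SiteY i, parKnitY i U z w ∈ G) : IsSymmTr (fun _ => (1 : ℝ)) (RY i (parKnitY i) (GpY i (parKnitY i)) U) :=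
  RY_isSymmTr i (parKnitY i) (GpY i (parKnitY i)) U (GpY_isSymmTr i (parKnitY i) U (symm0_parKnitY i hG hU hpar)) (adj_parKnitY i hG U hpar)

/-- ★ `⟨f, R(U)f⟩ = ⟨R(U)f, R(U)f⟩` at the knit letter — a symmetric idempotent is an orthogonal projection for the trace pairing.
[cite: Balaban1985BackgroundPropagators, (3.20) p.394 («orthogonal projection»), (3.25) p.394] -/
theorem trIP_RY_parKnitY_self (hG : G ≤ B7Prop2Explicit.unitaryUnits (Matrix (Fin N) (Fin N) ℂ)) {U : CfgY (Matrix (Fin N) (Fin N) ℂ) i}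
    (hU : ∀ μ x, U μ x ∈ G) (hpar : ∀ z w : SiteY i, parKnitY i U z w ∈ G) (f : SiteY i → Matrix (Fin N) (Fin N) ℂ) :
    trIP (fun _ => (1 : ℝ)) f (RY i (parKnitY i) (GpY i (parKnitY i)) U f)
      = trIP (fun _ => (1 : ℝ)) (RY i (parKnitY i) (GpY i (parKnitY i)) U f) (RY i (parKnitY i) (GpY i (parKnitY i)) U f) := by
  have h := RY_parKnitY_isSymmTr i hG hU hpar f (RY i (parKnitY i) (GpY i (parKnitY i)) U f)
  rw [← LinearMap.comp_apply, RY_parKnitY_idempotent i hG hU hpar] at h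
  exact h.symm

/-- hence `⟨f, R(U)f⟩ ≥ 0` at the knit letter. [cite: Balaban1985BackgroundPropagators, (3.20) p.394, (3.25) p.394] -/
theorem trIP_RY_parKnitY_self_nonneg (hG : G ≤ B7Prop2Explicit.unitaryUnits (Matrix (Fin N) (Fin N) ℂ))
    {U : CfgY (Matrix (Fin N) (Fin N) ℂ) i} (hU : ∀ μ x, U μ x ∈ G) (hpar : ∀ z w : SiteY i, parKnitY i U z w ∈ G) (f : SiteY i → Matrix (Fin N) (Fin N) ℂ) :
    0 ≤ trIP (fun _ => (1 : ℝ)) f (RY i (parKnitY i) (GpY i (parKnitY i)) U f) := by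
  rw [trIP_RY_parKnitY_self i hG hU hpar]
  exact trIP_self_nonneg _ (fun _ => one_pos) _

/-- ★ **`R(U)` IS AN `L²`-CONTRACTION at the knit letter: `⟨Rf, Rf⟩ ≤ ⟨f, f⟩`** — Pythagoras for the symmetric idempotent: `⟨f, f⟩ = ⟨Rf, Rf⟩ + ⟨f − Rf, f − Rf⟩`
(the (E15)-type bound of `R` in the `L²` norm, exactly, with constant `1`; print's (1.98) is the weighted sup-norm version, which needs Theorem 3.2).
[cite: Balaban1985BackgroundPropagators, (3.20) p.394 («orthogonal projection»), (3.25) p.394; Balaban1985RegularSpaces, (1.98) p.92] -/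
theorem trIP_RY_parKnitY_self_le (hG : G ≤ B7Prop2Explicit.unitaryUnits (Matrix (Fin N) (Fin N) ℂ)) {U : CfgY (Matrix (Fin N) (Fin N) ℂ) i}
    (hU : ∀ μ x, U μ x ∈ G) (hpar : ∀ z w : SiteY i, parKnitY i U z w ∈ G) (f : SiteY i → Matrix (Fin N) (Fin N) ℂ) :
    trIP (fun _ => (1 : ℝ)) (RY i (parKnitY i) (GpY i (parKnitY i)) U f) (RY i (parKnitY i) (GpY i (parKnitY i)) U f)
      ≤ trIP (fun _ => (1 : ℝ)) f f := by
  set g := RY i (parKnitY i) (GpY i (parKnitY i)) U f with hg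
  have h1 : trIP (fun _ => (1 : ℝ)) f g = trIP (fun _ => (1 : ℝ)) g g := trIP_RY_parKnitY_self i hG hU hpar f
  have hpyth : trIP (fun _ => (1 : ℝ)) f f = trIP (fun _ => (1 : ℝ)) g g + trIP (fun _ => (1 : ℝ)) (f - g) (f - g) := by
    rw [B9Eq3132CoerciveVariational.trIP_sub_left, B9Eq3132CoerciveVariational.trIP_sub_right, B9Eq3132CoerciveVariational.trIP_sub_right,
      B9Eq3132CoerciveVariational.trIP_comm g f, h1]
    ring
  rw [hpyth]
  linarith [trIP_self_nonneg (fun _ => (1 : ℝ)) (fun _ => one_pos) (f - g)]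

end Projection

/-! ## §3 The consumer's shapes: (E2) `Q′G′G′Q′ᵀCQ′f = Q′f`, (U2) `Q′ᵀCQ′G′G′Q′ᵀφ = Q′ᵀφ` -/

section Consumer

variable {𝔸 : Type} [NormedRing 𝔸] [NormedAlgebra ℂ 𝔸] [CompleteSpace 𝔸]

/-- (E2)-shape, ANY transporters and ANY letter `Gp` with `X = Q′GpGpQ′\*` a unit: `Q′(Gp(Gp(Q′\*(X⁻¹(Q′f))))) = Q′f`.
[cite: Balaban1985BackgroundPropagators, (3.25) p.394; Balaban1985RegularSpaces, (1.95) p.92, p.93, bookkeeping] -/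
theorem E2_of_isUnit_XY (parS : SiteParY 𝔸 i) (Gp : SiteOpY 𝔸 i) (U : CfgY 𝔸 i) (hX : IsUnit (XY i parS Gp U)) (f : SiteY i → 𝔸) :
    QpY i parS U (Gp U (Gp U (QpsY i parS U (XinvY i parS Gp U (QpY i parS U f))))) = QpY i parS U f := by
  have h := LinearMap.congr_fun (Ring.mul_inverse_cancel _ hX) (QpY i parS U f)
  rw [Module.End.mul_apply, Module.End.one_apply] at h
  exact h

/-- (U2)-shape, ANY transporters and ANY letter `Gp` with `X` a unit: `Q′\*(X⁻¹(Q′(Gp(Gp(Q′\*φ))))) = Q′\*φ`.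
[cite: Balaban1985BackgroundPropagators, (3.25) p.394; Balaban1985RegularSpaces, (1.95) p.92, p.93, bookkeeping] -/
theorem U2_of_isUnit_XY (parS : SiteParY 𝔸 i) (Gp : SiteOpY 𝔸 i) (U : CfgY 𝔸 i) (hX : IsUnit (XY i parS Gp U)) (φ : BlkY i → 𝔸) :
    QpsY i parS U (XinvY i parS Gp U (QpY i parS U (Gp U (Gp U (QpsY i parS U φ))))) = QpsY i parS U φ := by
  have h := LinearMap.congr_fun (Ring.inverse_mul_cancel _ hX) φ
  rw [Module.End.mul_apply, Module.End.one_apply] at h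
  exact congrArg (QpsY i parS U) h

/-- ★★ **(E2) `cinv_range` AT THE KNIT LETTER, EXACTLY**: `Q′(G′(G′(Q′\*(C(Q′f))))) = Q′f` with `C = (Q′G′²Q′\*)⁻¹(U; parKnitY)`, every `f`, at every `G`-valued `U`
with `G`-valued knit legs. [cite: Balaban1985BackgroundPropagators, (3.25) p.394, p.395; Balaban1985RegularSpaces, p.93 («Q′G′R = 0»)] -/
theorem knit_E2 (hG : G ≤ B7Prop2Explicit.unitaryUnits (Matrix (Fin N) (Fin N) ℂ)) {U : CfgY (Matrix (Fin N) (Fin N) ℂ) i}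
    (hU : ∀ μ x, U μ x ∈ G) (hpar : ∀ z w : SiteY i, parKnitY i U z w ∈ G) (f : SiteY i → Matrix (Fin N) (Fin N) ℂ) :
    QpY i (parKnitY i) U (GpY i (parKnitY i) U (GpY i (parKnitY i) U (QpsY i (parKnitY i) U
      (XinvY i (parKnitY i) (GpY i (parKnitY i)) U (QpY i (parKnitY i) U f))))) = QpY i (parKnitY i) U f :=
  E2_of_isUnit_XY i (parKnitY i) (GpY i (parKnitY i)) U (isUnit_XY_parKnitY i hG hU hpar) f

/-- ★★ **(U2) `cinv_range'` AT THE KNIT LETTER, EXACTLY**: `Q′\*(C(Q′(G′(G′(Q′\*φ))))) = Q′\*φ`, every `φ`. [cite: Balaban1985BackgroundPropagators, (3.25) p.394, p.395; Balaban1985RegularSpaces, Prop. 5 p.94 (uniqueness half)] -/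
theorem knit_U2 (hG : G ≤ B7Prop2Explicit.unitaryUnits (Matrix (Fin N) (Fin N) ℂ)) {U : CfgY (Matrix (Fin N) (Fin N) ℂ) i}
    (hU : ∀ μ x, U μ x ∈ G) (hpar : ∀ z w : SiteY i, parKnitY i U z w ∈ G) (φ : BlkY i → Matrix (Fin N) (Fin N) ℂ) :
    QpsY i (parKnitY i) U (XinvY i (parKnitY i) (GpY i (parKnitY i)) U (QpY i (parKnitY i) U
      (GpY i (parKnitY i) U (GpY i (parKnitY i) U (QpsY i (parKnitY i) U φ))))) = QpsY i (parKnitY i) U φ :=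
  U2_of_isUnit_XY i (parKnitY i) (GpY i (parKnitY i)) U (isUnit_XY_parKnitY i hG hU hpar) φ

/-- (E2) at the `c`-scaled letter `c·G′(U; parKnitY)` (`c ≠ 0`; the consumer's `η²G′`), with `C_c = (Q′(cG′)²Q′\*)⁻¹`. [cite: Balaban1985BackgroundPropagators, (3.25) p.394; Balaban1985RegularSpaces, (1.95) p.92, p.93] -/
theorem knit_E2_smul (hG : G ≤ B7Prop2Explicit.unitaryUnits (Matrix (Fin N) (Fin N) ℂ)) {U : CfgY (Matrix (Fin N) (Fin N) ℂ) i}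
    (hU : ∀ μ x, U μ x ∈ G) (hpar : ∀ z w : SiteY i, parKnitY i U z w ∈ G) {c : ℂ} (hc : c ≠ 0) (f : SiteY i → Matrix (Fin N) (Fin N) ℂ) :
    QpY i (parKnitY i) U ((c • GpY i (parKnitY i)) U ((c • GpY i (parKnitY i)) U (QpsY i (parKnitY i) U
      (XinvY i (parKnitY i) (c • GpY i (parKnitY i)) U (QpY i (parKnitY i) U f))))) = QpY i (parKnitY i) U f :=
  E2_of_isUnit_XY i (parKnitY i) (c • GpY i (parKnitY i)) U (isUnit_XY_smul_GpY_parKnitY i hG hU hpar hc) f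

/-- (U2) at the `c`-scaled letter. [cite: Balaban1985BackgroundPropagators, (3.25) p.394; Balaban1985RegularSpaces, Prop. 5 p.94] -/
theorem knit_U2_smul (hG : G ≤ B7Prop2Explicit.unitaryUnits (Matrix (Fin N) (Fin N) ℂ)) {U : CfgY (Matrix (Fin N) (Fin N) ℂ) i}
    (hU : ∀ μ x, U μ x ∈ G) (hpar : ∀ z w : SiteY i, parKnitY i U z w ∈ G) {c : ℂ} (hc : c ≠ 0) (φ : BlkY i → Matrix (Fin N) (Fin N) ℂ) :
    QpsY i (parKnitY i) U (XinvY i (parKnitY i) (c • GpY i (parKnitY i)) U (QpY i (parKnitY i) U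
      ((c • GpY i (parKnitY i)) U ((c • GpY i (parKnitY i)) U (QpsY i (parKnitY i) U φ))))) = QpsY i (parKnitY i) U φ :=
  U2_of_isUnit_XY i (parKnitY i) (c • GpY i (parKnitY i)) U (isUnit_XY_smul_GpY_parKnitY i hG hU hpar hc) φ

/-- `R` does not see the units of `G′`: the projection at `c·G′(U; parKnitY)` is the projection at `G′(U; parKnitY)` (def-Y's `RY_smul_Gp`).
[cite: Balaban1985BackgroundPropagators, (3.25) p.394, bookkeeping] -/
theorem RY_parKnitY_smul (U : CfgY (Matrix (Fin N) (Fin N) ℂ) i) {c : ℂ} (hc : c ≠ 0) :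
    RY i (parKnitY i) (c • GpY i (parKnitY i)) U = RY i (parKnitY i) (GpY i (parKnitY i)) U :=
  RY_smul_Gp i (parKnitY i) (GpY i (parKnitY i)) hc U

end Consumer

/-! ## §4 (E16): `C(U)` and `R(U)` at the knit letter are real — hermitian data give hermitian values -/

section Reality

/-- `C(U) = (Q′G′²Q′\*)⁻¹` at the knit letter is real (def-Y's `XinvY_isRealOpY` at `par := parKnitY`). [cite: Balaban1985BackgroundPropagators, (3.25) p.394, p.391 (hermitian-valued functions)] -/
theorem XinvY_parKnitY_isRealOpY (hG : G ≤ B7Prop2Explicit.unitaryUnits (Matrix (Fin N) (Fin N) ℂ)) {U : CfgY (Matrix (Fin N) (Fin N) ℂ) i}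
    (hU : ∀ μ x, U μ x ∈ G) (hpar : ∀ z w : SiteY i, parKnitY i U z w ∈ G) : IsRealOpY (XinvY i (parKnitY i) (GpY i (parKnitY i)) U) :=
  XinvY_isRealOpY i U (parKnitY i) (GpY i (parKnitY i)) (fun z w => B7Prop2Explicit.mem_unitaryUnits.mp (hG (hpar z w)))
    (GpY_isRealOpY i U (fun μ x => B7Prop2Explicit.mem_unitaryUnits.mp (hG (hU μ x))) (parKnitY i)
      fun z w => B7Prop2Explicit.mem_unitaryUnits.mp (hG (hpar z w)))

/-- ★ `R(U)` at the knit letter is real (def-Y's `RY_isRealOpY` at `par := parKnitY`). [cite: Balaban1985BackgroundPropagators, (3.25) p.394, p.391; Balaban1985RegularSpaces, (1.98) p.92] -/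
theorem RY_parKnitY_isRealOpY (hG : G ≤ B7Prop2Explicit.unitaryUnits (Matrix (Fin N) (Fin N) ℂ)) {U : CfgY (Matrix (Fin N) (Fin N) ℂ) i}
    (hU : ∀ μ x, U μ x ∈ G) (hpar : ∀ z w : SiteY i, parKnitY i U z w ∈ G) : IsRealOpY (RY i (parKnitY i) (GpY i (parKnitY i)) U) :=
  RY_isRealOpY i U (parKnitY i) (GpY i (parKnitY i)) (fun z w => B7Prop2Explicit.mem_unitaryUnits.mp (hG (hpar z w)))
    (GpY_isRealOpY i U (fun μ x => B7Prop2Explicit.mem_unitaryUnits.mp (hG (hU μ x))) (parKnitY i)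
      fun z w => B7Prop2Explicit.mem_unitaryUnits.mp (hG (hpar z w)))

/-- ★★ **(E16) `r_real` AT THE KNIT LETTER**: for hermitian-valued `f`, `(Rf)(z) = f(z) − (G′Q′\*CQ′G′f)(z)` is hermitian at every `z`.
[cite: Balaban1985BackgroundPropagators, p.391 («functions with values in N × N hermitian matrices»), (3.25) p.394; Balaban1985RegularSpaces, (1.98) p.92, (1.100) p.93] -/
theorem isSelfAdjoint_RY_parKnitY_apply (hG : G ≤ B7Prop2Explicit.unitaryUnits (Matrix (Fin N) (Fin N) ℂ)) {U : CfgY (Matrix (Fin N) (Fin N) ℂ) i}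
    (hU : ∀ μ x, U μ x ∈ G) (hpar : ∀ z w : SiteY i, parKnitY i U z w ∈ G) {f : SiteY i → Matrix (Fin N) (Fin N) ℂ}
    (hf : ∀ w, IsSelfAdjoint (f w)) (z : SiteY i) : IsSelfAdjoint (RY i (parKnitY i) (GpY i (parKnitY i)) U f z) := by
  have hstar : star f = f := funext fun w => (hf w).star_eq
  have h := congrFun ((RY_parKnitY_isRealOpY i hG hU hpar).apply_eq_of_star_eq hstar) z
  rwa [Pi.star_apply] at h

end Reality

/-! ## §5 [B8] (1.91)'s `H′ = G′²Q′*(Q′G′²Q′*)⁻¹` at the knit letter: (E11) `Q′H′ = 1` exactly and (E10) reality -/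

section Hprime

variable {𝔸 : Type} [NormedRing 𝔸] [NormedAlgebra ℂ 𝔸] [CompleteSpace 𝔸] in
/-- (E11)-shape, ANY transporters and ANY letter `Gp` with `X = Q′GpGpQ′\*` a unit: `Q′(Gp(Gp(Q′\*(X⁻¹Y)))) = Y` — `Q′H′ = 1` for `H′ = Gp²Q′\*X⁻¹`.
[cite: Balaban1985RegularSpaces, (1.91) p.91 («H′ = G′²Q′\*(Q′G′²Q′\*)⁻¹»); Balaban1985BackgroundPropagators, (3.25) p.394, bookkeeping] -/
theorem E11_of_isUnit_XY (parS : SiteParY 𝔸 i) (Gp : SiteOpY 𝔸 i) (U : CfgY 𝔸 i) (hX : IsUnit (XY i parS Gp U)) (Y : BlkY i → 𝔸) :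
    QpY i parS U (Gp U (Gp U (QpsY i parS U (XinvY i parS Gp U Y)))) = Y := by
  have h := LinearMap.congr_fun (Ring.mul_inverse_cancel _ hX) Y
  rw [Module.End.mul_apply, Module.End.one_apply] at h
  exact h

/-- ★★ **(E11) `qp_hp` AT THE KNIT LETTER, EXACTLY**: with `H′ = G′²Q′\*C`, `C = (Q′G′²Q′\*)⁻¹(U; parKnitY)` ([B8] (1.91)), `Q′(H′Y) = Y` for every block datum `Y`,
at every `G`-valued `U` with `G`-valued knit legs, `G ≤ U(N)`. [cite: Balaban1985RegularSpaces, (1.91) p.91; Balaban1985BackgroundPropagators, (3.25) p.394, p.395] -/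
theorem knit_E11 (hG : G ≤ B7Prop2Explicit.unitaryUnits (Matrix (Fin N) (Fin N) ℂ)) {U : CfgY (Matrix (Fin N) (Fin N) ℂ) i}
    (hU : ∀ μ x, U μ x ∈ G) (hpar : ∀ z w : SiteY i, parKnitY i U z w ∈ G) (Y : BlkY i → Matrix (Fin N) (Fin N) ℂ) :
    QpY i (parKnitY i) U (GpY i (parKnitY i) U (GpY i (parKnitY i) U (QpsY i (parKnitY i) U
      (XinvY i (parKnitY i) (GpY i (parKnitY i)) U Y)))) = Y :=
  E11_of_isUnit_XY i (parKnitY i) (GpY i (parKnitY i)) U (isUnit_XY_parKnitY i hG hU hpar) Y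

/-- (E11) at the `c`-scaled letter `c·G′` (`c ≠ 0`; the consumer's `η²G′`), `H′_c = (cG′)²Q′\*(Q′(cG′)²Q′\*)⁻¹`. [cite: Balaban1985RegularSpaces, (1.91) p.91; Balaban1985BackgroundPropagators, (3.25) p.394] -/
theorem knit_E11_smul (hG : G ≤ B7Prop2Explicit.unitaryUnits (Matrix (Fin N) (Fin N) ℂ)) {U : CfgY (Matrix (Fin N) (Fin N) ℂ) i}
    (hU : ∀ μ x, U μ x ∈ G) (hpar : ∀ z w : SiteY i, parKnitY i U z w ∈ G) {c : ℂ} (hc : c ≠ 0) (Y : BlkY i → Matrix (Fin N) (Fin N) ℂ) :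
    QpY i (parKnitY i) U ((c • GpY i (parKnitY i)) U ((c • GpY i (parKnitY i)) U (QpsY i (parKnitY i) U
      (XinvY i (parKnitY i) (c • GpY i (parKnitY i)) U Y)))) = Y :=
  E11_of_isUnit_XY i (parKnitY i) (c • GpY i (parKnitY i)) U (isUnit_XY_smul_GpY_parKnitY i hG hU hpar hc) Y

/-- ★ `H′ = G′²Q′\*C` at the knit letter COMMUTES WITH CONJUGATION: `H′(Y⋆) = (H′Y)⋆` (def-Y's reality calculus, letter by letter).
[cite: Balaban1985RegularSpaces, (1.91) p.91; Balaban1985BackgroundPropagators, p.391 («functions with values in N × N hermitian matrices»)] -/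
theorem knit_Hprime_star (hG : G ≤ B7Prop2Explicit.unitaryUnits (Matrix (Fin N) (Fin N) ℂ)) {U : CfgY (Matrix (Fin N) (Fin N) ℂ) i}
    (hU : ∀ μ x, U μ x ∈ G) (hpar : ∀ z w : SiteY i, parKnitY i U z w ∈ G) (Y : BlkY i → Matrix (Fin N) (Fin N) ℂ) :
    GpY i (parKnitY i) U (GpY i (parKnitY i) U (QpsY i (parKnitY i) U (XinvY i (parKnitY i) (GpY i (parKnitY i)) U (star Y))))
      = star (GpY i (parKnitY i) U (GpY i (parKnitY i) U (QpsY i (parKnitY i) U (XinvY i (parKnitY i) (GpY i (parKnitY i)) U Y)))) := by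
  have hS : ∀ z w : SiteY i, ((parKnitY i U z w : (Matrix (Fin N) (Fin N) ℂ)ˣ) : Matrix (Fin N) (Fin N) ℂ) ∈ unitary (Matrix (Fin N) (Fin N) ℂ) :=
    fun z w => B7Prop2Explicit.mem_unitaryUnits.mp (hG (hpar z w))
  have hGp : IsRealOpY (GpY i (parKnitY i) U) :=
    GpY_isRealOpY i U (fun μ x => B7Prop2Explicit.mem_unitaryUnits.mp (hG (hU μ x))) (parKnitY i) hS
  rw [(XinvY_parKnitY_isRealOpY i hG hU hpar).apply, (QpsY_isRealOpY i U (parKnitY i) hS).apply, hGp.apply, hGp.apply]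

/-- ★★ **(E10) `hp_real` AT THE KNIT LETTER, in the consumer's shape**: `Y = −X⋆` pointwise ⇒ `H′Y = −(H′X)⋆` pointwise (`H′ = G′²Q′\*C` at `parKnitY`).
[cite: Balaban1985RegularSpaces, (1.91)–(1.92) p.91; Balaban1985BackgroundPropagators, p.391] -/
theorem knit_E10 (hG : G ≤ B7Prop2Explicit.unitaryUnits (Matrix (Fin N) (Fin N) ℂ)) {U : CfgY (Matrix (Fin N) (Fin N) ℂ) i}
    (hU : ∀ μ x, U μ x ∈ G) (hpar : ∀ z w : SiteY i, parKnitY i U z w ∈ G) {Xf Yf : BlkY i → Matrix (Fin N) (Fin N) ℂ}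
    (hY : ∀ p, Yf p = -star (Xf p)) (z : SiteY i) :
    GpY i (parKnitY i) U (GpY i (parKnitY i) U (QpsY i (parKnitY i) U (XinvY i (parKnitY i) (GpY i (parKnitY i)) U Yf))) z
      = -star (GpY i (parKnitY i) U (GpY i (parKnitY i) U (QpsY i (parKnitY i) U (XinvY i (parKnitY i) (GpY i (parKnitY i)) U Xf))) z) := by
  have hfun : Yf = -star Xf := funext fun p => by rw [hY, Pi.neg_apply, Pi.star_apply]
  rw [hfun, map_neg, map_neg, map_neg, map_neg, knit_Hprime_star i hG hU hpar Xf, Pi.neg_apply, Pi.star_apply]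

/-- (E10), hermitian form: hermitian-valued `Y` ⇒ `H′Y` hermitian-valued at every site. [cite: Balaban1985RegularSpaces, (1.91) p.91; Balaban1985BackgroundPropagators, p.391] -/
theorem isSelfAdjoint_knit_Hprime_apply (hG : G ≤ B7Prop2Explicit.unitaryUnits (Matrix (Fin N) (Fin N) ℂ)) {U : CfgY (Matrix (Fin N) (Fin N) ℂ) i}
    (hU : ∀ μ x, U μ x ∈ G) (hpar : ∀ z w : SiteY i, parKnitY i U z w ∈ G) {Y : BlkY i → Matrix (Fin N) (Fin N) ℂ}
    (hYh : ∀ p, IsSelfAdjoint (Y p)) (z : SiteY i) :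
    IsSelfAdjoint (GpY i (parKnitY i) U (GpY i (parKnitY i) U (QpsY i (parKnitY i) U (XinvY i (parKnitY i) (GpY i (parKnitY i)) U Y))) z) := by
  have hstar : star Y = Y := funext fun p => (hYh p).star_eq
  have h := congrFun (knit_Hprime_star i hG hU hpar Y) z
  rw [hstar, Pi.star_apply] at h
  exact h.symm

end Hprime

end Literature.MathematicalPhysics.QuantumFieldTheory.Balaban1983to89.B9B8KnitLetterProjectionC

end
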